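import Summits.HodgeConjecture.HodgeConjecture.Theorems.F0P3cStCharTSTorusUnipotentConj   -- ★ «TN-CONJ★» (LH1-p01 g3): (N1) `exists_conj_eq_mul`, (N2) `eq_of_conj_eq_mul`, `conj_eq_mul_iff_torusConj_eq`, root units
import Literature.NumberTheory.Automorphic.UnitaryGroupHeisenbergRingRegularTwist          -- ★ regular twist in coordinates: `coe_mul_torus_mul_inv`, `heisX_torusConj_mul_inv`, `coe_heisY_torusConj_mul_inv`
import Mathlib.RingTheory.Valuation.Basic
import HarnessLib

/-!
# F0 · P3c · line LH6 «StCharTS» — ROAD «JAC-LOC» brick (J3) «N-COMMUTATOR BOX BIJECTION»: for a REGULAR diagonal `t`, the regular twist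
# `n′ ↦ t⁻¹n′t·n′⁻¹` is a BIJECTION between valuation boxes of `N`, scaling the `x`-radius by `|a − 1|` and the `y`-radius by `|b − 1|`
# (the level-set shadow of `|det(1 − Ad t)|_𝔫|`; Harish-Chandra 1970 Lemma 22, van Dijk 1972 §2, Rogawski 1990 §12.5 p. 182)

Cell `pub/hodgecm-mathlib`, crux H413 = `stmt-HodgeConjecture-24833` (lane `--supports … --as helper`), route HCCMUnconditional; seat LH6-p03 (g5), holder of the road
«JAC-LOC» (bus F0∕P3b 2026-09-02T14:11:30Z): the LOCAL tube Jacobian `hJacLoc` of ★ p851645 `…WeylHypJacobianLocal` for the split torus of `U(Φ₃)(L⁺_v)` by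
level-subgroup bookkeeping.  THEOREMS ONLY, sorry-free, no definition ∕ instance ∕ notation ∕ named fact; imports ★ TN-CONJ, the ★ regular-twist file and
Mathlib valuations.

SETTING (★ TN-CONJ's, generic): `U = ↥(unitaryGroupOfForm σ J)` over a commutative ring `R` with an involution `σ` and `2 ∈ Rˣ`, `J = Φ₃`, `T = torusU σ J`,
`N = unipotentU σ J` with the ★ Heisenberg chart `n ↦ (x(n), y(n)) ∈ R × R⁻` (`heisX`, `heisY`); a regular `t = diag(d) ∈ T` has the ROOT UNITS `a − 1`, `b − 1`
(`a = d₀⁻¹d₁`, `b = d₀⁻¹d₂`, ★ `isUnit_rootA_sub_one` ∕ `isUnit_rootB_sub_one`).  NEW here: any valuation `v : Valuation R Γ₀` with `v ∘ σ = v` (for the road: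
`R = L_w`, `v` its valuation, `σ` the conjugation of `L_w ∕ L⁺_v`).

THE MAP.  `ψ_t(n′) := t⁻¹ n′ t · n′⁻¹ ∈ N` (`torusConj σ t n′ * n′⁻¹`, the REGULAR TWIST of ★ `UnitaryGroupHeisenbergRingRegularTwist`), the element with
`n′ t n′⁻¹ = t · ψ_t(n′)` (★ `coe_mul_torus_mul_inv`); ★ TN-CONJ proves that for regular `t` it is a bijection `N → N`, ★ `heisX_torusConj_mul_inv` ∕
★ `coe_heisY_torusConj_mul_inv` give its chart formulas `x(ψ_t n′) = (a − 1)·x(n′)`, `y(ψ_t n′) = (b − 1)·y(n′) + ½(a − σa)·x(n′)σx(n′)`, and ★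
`map_torusConj_mul_inv_eq_smul` its Haar MODULE.  This file is the LEVEL-SET companion that the orbit-tube count of the road needs.

THE RESULT (§2) **`bijOn_vanDijk_box`**: for radii `ρx ρy : Γ₀` with the DEPTH CONDITION `v(½)·v(a − σa)·ρx·ρx ≤ v(b − 1)·ρy` (automatic for small `ρx` at fixed
`ρy∕ρx`, e.g. on the level boxes `N ∩ K_j`, `j ≫ j₀(t)`), `ψ_t` is a BIJECTION from the box `{v(x n′) ≤ ρx ∧ v(y n′) ≤ ρy}` ONTO the box
`{v(x n) ≤ v(a−1)·ρx ∧ v(y n) ≤ v(b−1)·ρy}`; equivalently (**`image_conj_box`**) `{n′ t n′⁻¹ : n′ ∈ BOX(ρx, ρy)} = t · BOX(v(a−1)ρx, v(b−1)ρy)` in `U`.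
This is the `N`-half of the ORBIT-TUBE lemma of the road ((J4): `{k s τ k⁻¹ : k ∈ K_j, τ ∈ T_j} = s · N⁻_{j+ᾱ,j+β̄} T_j N_{j+α,j+β}`), whose index count is the Jacobian
`|det(1 − Ad s)|_{𝔤∕𝔱}|` of [HarishChandra1970, Lemma 22]; the `N⁻` twin (J3⁻) follows through the Weyl element (★ `exists_weylConj_conj_eq_mul`).

* §1 `v_heisX_vanDijk`, `v_heisY_vanDijk_le` — valuations of the image coordinates.
* §2 `mapsTo_vanDijk_box`, `injOn_vanDijk`, `surjOn_vanDijk_box`, `bijOn_vanDijk_box`, `image_conj_box`.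

HONEST LABEL: count-neutral algebra for the road «JAC-LOC» (hyperbolic half of the print residue «WIF» of the (S-𝔇) organ `stub_EllipticPackage`); closes no organ.
HC_CM is proved only modulo the 7 printed citations (2 remaining: hLiu418 = `stmt-HodgeConjecture-24832`, h413 = `stmt-HodgeConjecture-24833`) until rung 0 closes.

## References
* [HarishChandra1970] Harish-Chandra, *Harmonic analysis on reductive p-adic groups*, LNM 162 (1970), Lemma 22 (the Jacobian of `(x, t) ↦ x t x⁻¹`).
* [vanDijk1972] G. van Dijk, *Computation of certain induced characters of p-adic groups*, Math. Ann. 199 (1972) 229–240, §2 (`n ↦ t⁻¹ n⁻¹ t n` on `N`).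
* [Rogawski1990] J. D. Rogawski, *Automorphic Representations of Unitary Groups in Three Variables*, Ann. of Math. Stud. 123 (1990), §1.10 p. 9 (`N`, `M`),
  §12.5 p. 182 (Weyl integration formula), Lemma 12.7.1 p. 191.
-/

set_option autoImplicit false
-- the mandated namespace has the single-problem summit's repeated segment (`HodgeConjecture.HodgeConjecture`)
set_option linter.dupNamespace false

open Matrix
open Literature.NumberTheory.Automorphic Literature.NumberTheory.Automorphic.UnitaryGroup Literature.NumberTheory.Automorphic.UnitaryGroup.HeisRing
open Literature.NumberTheory.Rogawski1990
open Summit.HodgeConjecture.HodgeConjecture.Cruxes.H413.F0P3cStCharTSTorusUnipotentConj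
open scoped MatrixGroups

namespace Summit.HodgeConjecture.HodgeConjecture.Cruxes.H413.F0P3cStCharTSVanDijkBox

variable {R : Type*} [CommRing R] (σ : R →+* R) (hσ : ∀ x, σ (σ x) = x) {J : Matrix (Fin 3) (Fin 3) R}
  [Invertible (2 : R)] (hJ : J = (StdForm.antidiagonal 3).over R)
  {Γ₀ : Type*} [LinearOrderedCommGroupWithZero Γ₀] (v : Valuation R Γ₀) (hv : ∀ x, v (σ x) = v x)

/-! ## §1 Valuations of the image coordinates -/

omit [Invertible (2 : R)] in
/-- **`v(x(ψ_t n′)) = v(a − 1)·v(x(n′))`** (★ `heisX_torusConj_mul_inv`). [cite: vanDijk1972, §2] -/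
theorem v_heisX_vanDijk (t : ↥(torusU σ J)) {d : Fin 3 → Rˣ} (hd : glDiagonal 3 R d = ((t : ↥(unitaryGroupOfForm σ J)) : GL (Fin 3) R))
    (n' : ↥(unipotentU σ J)) :
    v (heisX σ (torusConj σ t n' * n'⁻¹)) = v ((((d 0)⁻¹ * d 1 : Rˣ) : R) - 1) * v (heisX σ n') := by
  rw [heisX_torusConj_mul_inv σ t hd, map_mul]

include hv in
/-- **`v(y(ψ_t n′)) ≤ v(b − 1)·ρy`** whenever `v(x n′) ≤ ρx`, `v(y n′) ≤ ρy` and the DEPTH CONDITION `v(½)·v(a − σa)·ρx·ρx ≤ v(b − 1)·ρy` holds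
(ultrametric inequality on ★ `coe_heisY_torusConj_mul_inv`; `v(σ x′) = v(x′)`). [cite: vanDijk1972, §2] [cite: HarishChandra1970, Lemma 22] -/
theorem v_heisY_vanDijk_le (t : ↥(torusU σ J)) {d : Fin 3 → Rˣ} (hd : glDiagonal 3 R d = ((t : ↥(unitaryGroupOfForm σ J)) : GL (Fin 3) R))
    {ρx ρy : Γ₀}
    (hρ : v (⅟(2 : R)) * v ((((d 0)⁻¹ * d 1 : Rˣ) : R) - σ (((d 0)⁻¹ * d 1 : Rˣ) : R)) * (ρx * ρx) ≤ v ((((d 0)⁻¹ * d 2 : Rˣ) : R) - 1) * ρy)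
    (n' : ↥(unipotentU σ J)) (hx : v (heisX σ n') ≤ ρx) (hy : v (heisY σ hσ hJ n' : R) ≤ ρy) :
    v (heisY σ hσ hJ (torusConj σ t n' * n'⁻¹) : R) ≤ v ((((d 0)⁻¹ * d 2 : Rˣ) : R) - 1) * ρy := by
  rw [coe_heisY_torusConj_mul_inv σ hσ hJ t hd]
  refine Valuation.map_add_le v ?_ ?_
  · rw [map_mul]
    exact mul_le_mul' le_rfl hy
  · rw [map_mul, map_mul, map_mul, hv]
    calc v (⅟(2 : R)) * v ((((d 0)⁻¹ * d 1 : Rˣ) : R) - σ (((d 0)⁻¹ * d 1 : Rˣ) : R)) * (v (heisX σ n') * v (heisX σ n'))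
        ≤ v (⅟(2 : R)) * v ((((d 0)⁻¹ * d 1 : Rˣ) : R) - σ (((d 0)⁻¹ * d 1 : Rˣ) : R)) * (ρx * ρx) :=
          mul_le_mul' le_rfl (mul_le_mul' hx hx)
      _ ≤ v ((((d 0)⁻¹ * d 2 : Rˣ) : R) - 1) * ρy := hρ

/-! ## §2 The box bijection -/

include hv in
/-- **`ψ_t` maps `BOX(ρx, ρy)` into `BOX(v(a−1)·ρx, v(b−1)·ρy)`** under the depth condition (§1; no regularity needed). [cite: vanDijk1972, §2] -/
theorem mapsTo_vanDijk_box (t : ↥(torusU σ J)) {d : Fin 3 → Rˣ} (hd : glDiagonal 3 R d = ((t : ↥(unitaryGroupOfForm σ J)) : GL (Fin 3) R))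
    {ρx ρy : Γ₀}
    (hρ : v (⅟(2 : R)) * v ((((d 0)⁻¹ * d 1 : Rˣ) : R) - σ (((d 0)⁻¹ * d 1 : Rˣ) : R)) * (ρx * ρx) ≤ v ((((d 0)⁻¹ * d 2 : Rˣ) : R) - 1) * ρy) :
    Set.MapsTo (fun n' : ↥(unipotentU σ J) => torusConj σ t n' * n'⁻¹)
      {n' | v (heisX σ n') ≤ ρx ∧ v (heisY σ hσ hJ n' : R) ≤ ρy}
      {n | v (heisX σ n) ≤ v ((((d 0)⁻¹ * d 1 : Rˣ) : R) - 1) * ρx ∧ v (heisY σ hσ hJ n : R) ≤ v ((((d 0)⁻¹ * d 2 : Rˣ) : R) - 1) * ρy} := by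
  rintro n' ⟨hx, hy⟩
  refine ⟨?_, v_heisY_vanDijk_le σ hσ hJ v hv t hd hρ n' hx hy⟩
  rw [v_heisX_vanDijk σ v t hd]
  exact mul_le_mul' le_rfl hx

include hσ hJ in
/-- **`ψ_t` is INJECTIVE on `N` for REGULAR `t`** (★ (N2) `eq_of_conj_eq_mul`: both `n′`, `n″` solve `n t n⁻¹ = t·ψ_t(n′)`, ★ `coe_mul_torus_mul_inv`).
[cite: vanDijk1972, §2] [cite: Rogawski1990, Lemma 12.7.1 p. 191] -/
theorem injOn_vanDijk (t : ↥(torusU σ J)) (hreg : IsRegularElt ((t : ↥(unitaryGroupOfForm σ J)) : GL (Fin 3) R)) (S : Set ↥(unipotentU σ J)) :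
    Set.InjOn (fun n' : ↥(unipotentU σ J) => torusConj σ t n' * n'⁻¹) S := by
  intro n' _ n'' _ h
  have h' := coe_mul_torus_mul_inv σ t n'
  have h'' := coe_mul_torus_mul_inv σ t n''
  have heq : torusConj σ t n'' * n''⁻¹ = torusConj σ t n' * n'⁻¹ := h.symm
  rw [heq] at h''
  exact eq_of_conj_eq_mul σ hσ hJ t hreg (torusConj σ t n' * n'⁻¹) h' h''

include hv in
/-- **`ψ_t` maps `BOX(ρx, ρy)` ONTO `BOX(v(a−1)·ρx, v(b−1)·ρy)`** for REGULAR `t` under the depth condition: the preimage `n′` of `n` (★ (N1) `exists_conj_eq_mul`)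
has `x(n) = (a−1)x(n′)` and `(b−1)y(n′) = y(n) − ½(a − σa)x(n′)σx(n′)` (★ twist coordinates) with `a − 1`, `b − 1` UNITS (★ root units), so
`v(x n′) = v((a−1)⁻¹)v(x n) ≤ ρx` and `v(y n′) ≤ v((b−1)⁻¹)·max(v(y n), v(½)v(a−σa)ρx²) ≤ ρy`. [cite: vanDijk1972, §2] [cite: HarishChandra1970, Lemma 22] -/
theorem surjOn_vanDijk_box (t : ↥(torusU σ J)) (hreg : IsRegularElt ((t : ↥(unitaryGroupOfForm σ J)) : GL (Fin 3) R))
    {d : Fin 3 → Rˣ} (hd : glDiagonal 3 R d = ((t : ↥(unitaryGroupOfForm σ J)) : GL (Fin 3) R)) {ρx ρy : Γ₀}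
    (hρ : v (⅟(2 : R)) * v ((((d 0)⁻¹ * d 1 : Rˣ) : R) - σ (((d 0)⁻¹ * d 1 : Rˣ) : R)) * (ρx * ρx) ≤ v ((((d 0)⁻¹ * d 2 : Rˣ) : R) - 1) * ρy) :
    Set.SurjOn (fun n' : ↥(unipotentU σ J) => torusConj σ t n' * n'⁻¹)
      {n' | v (heisX σ n') ≤ ρx ∧ v (heisY σ hσ hJ n' : R) ≤ ρy}
      {n | v (heisX σ n) ≤ v ((((d 0)⁻¹ * d 1 : Rˣ) : R) - 1) * ρx ∧ v (heisY σ hσ hJ n : R) ≤ v ((((d 0)⁻¹ * d 2 : Rˣ) : R) - 1) * ρy} := by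
  rintro n ⟨hxn, hyn⟩
  obtain ⟨n', hn'⟩ := exists_conj_eq_mul σ hσ hJ t hreg n
  -- `ψ_t n′ = n`
  have hψ : torusConj σ t n' * n'⁻¹ = n := by
    rw [(conj_eq_mul_iff_torusConj_eq σ t n n').1 hn', mul_inv_cancel_right]
  have hA := isUnit_rootA_sub_one σ t hd hreg
  have hB := isUnit_rootB_sub_one σ t hd hreg
  -- the `x`-coordinate: `x(n) = (a − 1) x(n′)` with `a − 1` a unit
  have ex : heisX σ n = ((((d 0)⁻¹ * d 1 : Rˣ) : R) - 1) * heisX σ n' := by rw [← hψ, heisX_torusConj_mul_inv σ t hd]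
  have ex' : heisX σ n' = ((hA.unit⁻¹ : Rˣ) : R) * heisX σ n := by
    rw [ex, ← mul_assoc, IsUnit.val_inv_mul, one_mul]
  have huA : v ((hA.unit⁻¹ : Rˣ) : R) * v ((((d 0)⁻¹ * d 1 : Rˣ) : R) - 1) = 1 := by
    rw [← map_mul, IsUnit.val_inv_mul, map_one]
  have hx' : v (heisX σ n') ≤ ρx := by
    calc v (heisX σ n') = v ((hA.unit⁻¹ : Rˣ) : R) * v (heisX σ n) := by rw [ex', map_mul]
      _ ≤ v ((hA.unit⁻¹ : Rˣ) : R) * (v ((((d 0)⁻¹ * d 1 : Rˣ) : R) - 1) * ρx) := mul_le_mul' le_rfl hxn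
      _ = ρx := by rw [← mul_assoc, huA, one_mul]
  refine ⟨n', ⟨hx', ?_⟩, hψ⟩
  -- the `y`-coordinate: `(b − 1) y(n′) = y(n) − ½ (a − σa) x′σx′` with `b − 1` a unit
  have ey : (heisY σ hσ hJ n : R) = ((((d 0)⁻¹ * d 2 : Rˣ) : R) - 1) * (heisY σ hσ hJ n' : R) +
      ⅟(2 : R) * ((((d 0)⁻¹ * d 1 : Rˣ) : R) - σ (((d 0)⁻¹ * d 1 : Rˣ) : R)) * (heisX σ n' * σ (heisX σ n')) := by
    rw [← hψ, coe_heisY_torusConj_mul_inv σ hσ hJ t hd]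
  have ey' : (heisY σ hσ hJ n' : R) = ((hB.unit⁻¹ : Rˣ) : R) *
      ((heisY σ hσ hJ n : R) - ⅟(2 : R) * ((((d 0)⁻¹ * d 1 : Rˣ) : R) - σ (((d 0)⁻¹ * d 1 : Rˣ) : R)) * (heisX σ n' * σ (heisX σ n'))) := by
    rw [ey, add_sub_cancel_right, ← mul_assoc, IsUnit.val_inv_mul, one_mul]
  have huB : v ((hB.unit⁻¹ : Rˣ) : R) * v ((((d 0)⁻¹ * d 2 : Rˣ) : R) - 1) = 1 := by
    rw [← map_mul, IsUnit.val_inv_mul, map_one]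
  have hdiff : v ((heisY σ hσ hJ n : R) - ⅟(2 : R) * ((((d 0)⁻¹ * d 1 : Rˣ) : R) - σ (((d 0)⁻¹ * d 1 : Rˣ) : R)) * (heisX σ n' * σ (heisX σ n'))) ≤
      v ((((d 0)⁻¹ * d 2 : Rˣ) : R) - 1) * ρy := by
    refine Valuation.map_sub_le v hyn ?_
    rw [map_mul, map_mul, map_mul, hv]
    calc v (⅟(2 : R)) * v ((((d 0)⁻¹ * d 1 : Rˣ) : R) - σ (((d 0)⁻¹ * d 1 : Rˣ) : R)) * (v (heisX σ n') * v (heisX σ n'))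
        ≤ v (⅟(2 : R)) * v ((((d 0)⁻¹ * d 1 : Rˣ) : R) - σ (((d 0)⁻¹ * d 1 : Rˣ) : R)) * (ρx * ρx) :=
          mul_le_mul' le_rfl (mul_le_mul' hx' hx')
      _ ≤ v ((((d 0)⁻¹ * d 2 : Rˣ) : R) - 1) * ρy := hρ
  calc v (heisY σ hσ hJ n' : R)
      = v ((hB.unit⁻¹ : Rˣ) : R) * v ((heisY σ hσ hJ n : R) - ⅟(2 : R) * ((((d 0)⁻¹ * d 1 : Rˣ) : R) - σ (((d 0)⁻¹ * d 1 : Rˣ) : R)) *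
          (heisX σ n' * σ (heisX σ n'))) := by rw [ey', map_mul]
    _ ≤ v ((hB.unit⁻¹ : Rˣ) : R) * (v ((((d 0)⁻¹ * d 2 : Rˣ) : R) - 1) * ρy) := mul_le_mul' le_rfl hdiff
    _ = ρy := by rw [← mul_assoc, huB, one_mul]

include hv in
/-- **(J3) THE BOX BIJECTION.**  For REGULAR `t = diag(d) ∈ T`, a valuation `v` with `v ∘ σ = v`, and radii with `v(½)·v(a − σa)·ρx·ρx ≤ v(b − 1)·ρy`:
`n′ ↦ t⁻¹n′t·n′⁻¹` is a bijection from `{n′ ∈ N | v(x n′) ≤ ρx, v(y n′) ≤ ρy}` onto `{n ∈ N | v(x n) ≤ v(a−1)ρx, v(y n) ≤ v(b−1)ρy}` — the level-set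
form of «the Jacobian of `n ↦ t⁻¹n t n⁻¹` on `N` is `|det(1 − Ad t)|_𝔫| = |a − 1|_{E}·|b − 1|_{F}`» (the Haar-module form is ★ `map_torusConj_mul_inv_eq_smul`).
[cite: HarishChandra1970, Lemma 22] [cite: vanDijk1972, §2] [cite: Rogawski1990, §12.5 p. 182] -/
theorem bijOn_vanDijk_box (t : ↥(torusU σ J)) (hreg : IsRegularElt ((t : ↥(unitaryGroupOfForm σ J)) : GL (Fin 3) R))
    {d : Fin 3 → Rˣ} (hd : glDiagonal 3 R d = ((t : ↥(unitaryGroupOfForm σ J)) : GL (Fin 3) R)) {ρx ρy : Γ₀}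
    (hρ : v (⅟(2 : R)) * v ((((d 0)⁻¹ * d 1 : Rˣ) : R) - σ (((d 0)⁻¹ * d 1 : Rˣ) : R)) * (ρx * ρx) ≤ v ((((d 0)⁻¹ * d 2 : Rˣ) : R) - 1) * ρy) :
    Set.BijOn (fun n' : ↥(unipotentU σ J) => torusConj σ t n' * n'⁻¹)
      {n' | v (heisX σ n') ≤ ρx ∧ v (heisY σ hσ hJ n' : R) ≤ ρy}
      {n | v (heisX σ n) ≤ v ((((d 0)⁻¹ * d 1 : Rˣ) : R) - 1) * ρx ∧ v (heisY σ hσ hJ n : R) ≤ v ((((d 0)⁻¹ * d 2 : Rˣ) : R) - 1) * ρy} :=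
  ⟨mapsTo_vanDijk_box σ hσ hJ v hv t hd hρ, injOn_vanDijk σ hσ hJ t hreg _, surjOn_vanDijk_box σ hσ hJ v hv t hreg hd hρ⟩

include hv in
/-- **The same bijection read in `U`: `{n′ t n′⁻¹ : n′ ∈ BOX(ρx, ρy)} = t · BOX(v(a−1)ρx, v(b−1)ρy)`** — the `N`-half of the road's ORBIT-TUBE identity
`{k s τ k⁻¹} = s · N⁻_{j+ᾱ,j+β̄} T_j N_{j+α,j+β}`. [cite: HarishChandra1970, Lemma 22] [cite: Rogawski1990, §12.5 p. 182; Lemma 12.7.1 p. 191] -/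
theorem image_conj_box (t : ↥(torusU σ J)) (hreg : IsRegularElt ((t : ↥(unitaryGroupOfForm σ J)) : GL (Fin 3) R))
    {d : Fin 3 → Rˣ} (hd : glDiagonal 3 R d = ((t : ↥(unitaryGroupOfForm σ J)) : GL (Fin 3) R)) {ρx ρy : Γ₀}
    (hρ : v (⅟(2 : R)) * v ((((d 0)⁻¹ * d 1 : Rˣ) : R) - σ (((d 0)⁻¹ * d 1 : Rˣ) : R)) * (ρx * ρx) ≤ v ((((d 0)⁻¹ * d 2 : Rˣ) : R) - 1) * ρy) :
    (fun n' : ↥(unipotentU σ J) => (n' : ↥(unitaryGroupOfForm σ J)) * t * (n' : ↥(unitaryGroupOfForm σ J))⁻¹) ''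
        {n' | v (heisX σ n') ≤ ρx ∧ v (heisY σ hσ hJ n' : R) ≤ ρy} =
      (fun n : ↥(unipotentU σ J) => (t : ↥(unitaryGroupOfForm σ J)) * n) ''
        {n | v (heisX σ n) ≤ v ((((d 0)⁻¹ * d 1 : Rˣ) : R) - 1) * ρx ∧ v (heisY σ hσ hJ n : R) ≤ v ((((d 0)⁻¹ * d 2 : Rˣ) : R) - 1) * ρy} := by
  have hbij := bijOn_vanDijk_box σ hσ hJ v hv t hreg hd hρ
  ext g
  constructor
  · rintro ⟨n', hn', rfl⟩
    exact ⟨torusConj σ t n' * n'⁻¹, hbij.mapsTo hn', (coe_mul_torus_mul_inv σ t n').symm⟩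
  · rintro ⟨n, hn, rfl⟩
    obtain ⟨n', hn', hψ⟩ := hbij.surjOn hn
    have hψ' : torusConj σ t n' * n'⁻¹ = n := hψ
    refine ⟨n', hn', ?_⟩
    change (n' : ↥(unitaryGroupOfForm σ J)) * t * (n' : ↥(unitaryGroupOfForm σ J))⁻¹ = (t : ↥(unitaryGroupOfForm σ J)) * n
    rw [coe_mul_torus_mul_inv σ t n', hψ']

end Summit.HodgeConjecture.HodgeConjecture.Cruxes.H413.F0P3cStCharTSVanDijkBox
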